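import Summits.HodgeConjecture.HodgeConjecture.Theorems.NoetherLefschetzOneUpK3TypeNetsSurfaceProductsHodge
import Literature.AlgebraicGeometry.HodgeTheory.HodgeClassOfMorphismDischarge

/-!
# Crux `K3TypeNets` (stmt-HodgeConjecture-11600), product sector — `HC(S₁ × S₂)` ⟺ the rational Hodge
# morphisms `H²(S₂) → H²(S₁)` are algebraic (kernel `Iff`, every pair of smooth projective surfaces)

Third helper for the product-sector line (stubs P2 `stub_k3Pairs` / P3: "`HC(2,2)` for `S₁ × S₂` —
EQUIVALENTLY every Hodge morphism `T(S₂)_ℚ → T(S₁)_ℚ` is induced by an algebraic class"). The sibling files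
give the direction ⟸ (`hodgeTwoTwo_algebraic_prod_of_transcendentalCorrespondences`); the direction ⟹ is
Voisin I Lemma 11.41 in the tree's discharged form (`exists_hodgeClass_corrAction_eq_smul_holds`: a rational
type-preserving `f : H²(S₂) → H²(S₁)` is `t • γ_*` for a RATIONAL `(2,2)`-class `γ` on `S₁ ⊗ S₂`, any
orientation family). Hence, with no named-fact hypothesis:

* `hodgeMorphism_induced_of_hodgeTwoTwo_algebraic_prod` — if every rational `(2,2)`-class on `S₁ ⊗ S₂` is
  algebraic, every rational Hodge morphism `H²(S₂) → H²(S₁)` is the action of an algebraic class;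
* `hodgeTwoTwo_algebraic_prod_iff_hodgeMorphisms_algebraic` — **`HC(2,2)(S₁ × S₂)` ⟺ every rational
  type-preserving `H²(S₂(ℂ); ℂ) → H²(S₁(ℂ); ℂ)` is `y ↦ pr₁_*(pr₂^* y ∪ γ)` for an algebraic `γ`**;
* `hodgeConjectureFor_prod_iff_hodgeMorphisms_algebraic` — the same with `HodgeConjectureFor 4 (S₁ ⊗ S₂)` on
  the left (codimensions `≠ 2` are unconditional on a fourfold).

So the product-sector stubs are LITERALLY the algebraicity of `Hom_Hdg(H²(S₂), H²(S₁))` (for K3 pairs: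
`Hom_Hdg(T(S₂), T(S₁))` plus divisors). No definition, no named-fact hypothesis, no sorry. Prover seat
ring2-b02 (gen 47).

References: Huybrechts, *Motives of isogenous K3 surfaces* (2019), §1; Varesco (2023), §2 p. 8; Voisin,
*Hodge Theory and Complex Algebraic Geometry I*, §11.3.3 Thm. 11.38 and Lemma 11.41.
-/

set_option linter.dupNamespace false

noncomputable section

namespace Summit.HodgeConjecture.HodgeConjecture.Theorems.SurfaceProducts

open scoped Manifold
open CategoryTheory MonoidalCategory CartesianMonoidalCategory
open Literature.AlgebraicGeometry Literature.AlgebraicGeometry.Motives Literature.AlgebraicGeometry.HodgeTheory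
open Literature.AlgebraicTopology.SingularHomology
open Summit.HodgeConjecture.HodgeConjecture.Theorems.NikulinTwinTransport

variable {S₁ S₂ : SchemeOver ℂ}

/-- `Corr[μ, h₁, h₂ ; γ, y] = pr₁_*(pr₂^* y ∪ γ) : H²(S₂(ℂ)) → H²(S₁(ℂ))`. Local notation only. -/
local notation3 (prettyPrint := false) "Corr[" μ ", " h₁ ", " h₂ " ; " γ ", " y "]" =>
  complexGysin μ (IsSmoothProjective.tensor_holds h₁ h₂) h₁
    (SemiCartesianMonoidalCategory.fst _ _) (rfl : 2 * 1 + 2 * 2 + 2 * 2 = 2 * 1 + 2 * (2 + 2))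
    (cupProduct (rfl : 2 * 1 + 2 * 2 = 2 * 1 + 2 * 2)
      (complexBetti.map (SemiCartesianMonoidalCategory.snd _ _) (2 * 1) y) γ)

/-- **If every rational `(2,2)`-class on `S₁ ⊗ S₂` is algebraic, every rational Hodge morphism
`H²(S₂(ℂ); ℂ) → H²(S₁(ℂ); ℂ)` is induced by an algebraic class** (for every orientation family): Voisin I
Lemma 11.41 in discharged form gives a rational `(2,2)`-class `γ` with `γ_* = t • f`, `t ≠ 0`, and `t⁻¹ • γ`
is algebraic by hypothesis. [cite: VoisinHodgeI2002, §11.3.3 Thm. 11.38 and Lemma 11.41] [cite: Huybrechts2019, §1] -/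
theorem hodgeMorphism_induced_of_hodgeTwoTwo_algebraic_prod (μ : OrientationFamily)
    (h₁ : IsSmoothProjective 2 S₁) (h₂ : IsSmoothProjective 2 S₂)
    (h22 : ∀ c : complexBetti (S₁ ⊗ S₂) (2 * 2), IsRationalClass c →
      IsOfHodgeType 4 (S₁ ⊗ S₂) (2 * 2) 2 2 c → c ∈ algebraicClasses (S₁ ⊗ S₂) 2)
    (f : complexBetti S₂ (2 * 1) →ₗ[ℂ] complexBetti S₁ (2 * 1))
    (hf_rat : ∀ y, IsRationalClass y → IsRationalClass (f y))
    (hf_typ : ∀ (i j : ℕ) y, IsOfHodgeType 2 S₂ (2 * 1) i j y → IsOfHodgeType 2 S₁ (2 * 1) i j (f y)) :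
    ∃ γ ∈ algebraicClasses (S₁ ⊗ S₂) 2, ∀ y : complexBetti S₂ (2 * 1), f y = Corr[μ, h₁, h₂ ; γ, y] := by
  have hI := hodgePQ_independent_of_hodgeModel_holds
  obtain ⟨A₁⟩ := nonempty_hodgeModel_holds (n := 2) (X := S₁) h₁
  obtain ⟨A₂⟩ := nonempty_hodgeModel_holds (n := 2) (X := S₂) h₂
  obtain ⟨γ, hγQ, hγT, t, ht0, hγ⟩ := exists_hodgeClass_corrAction_eq_smul_holds h₁ h₂ A₁ A₂
    (a := 2 * 1) (b := 2 * 1) (e := 2) (r := 0) (rfl : 2 * 1 + 2 * 2 = 2 * 1 + 2 * 2) (rfl : 2 + 0 = 2) f hf_rat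
    (fun p q _ c hc ↦ by
      rw [Nat.add_zero, Nat.add_zero]
      exact (hI.isOfHodgeType_iff h₁ A₁).1 (hf_typ p q c ((hI.isOfHodgeType_iff h₂ A₂).2 hc))) μ
  have hγalg : γ ∈ algebraicClasses (S₁ ⊗ S₂) 2 := h22 γ hγQ hγT
  refine ⟨t⁻¹ • γ, Submodule.smul_mem _ _ hγalg, fun y ↦ ?_⟩
  have h := LinearMap.congr_fun hγ y
  rw [LinearMap.smul_apply, corrAction_apply] at h
  rw [map_smul, map_smul, h, smul_smul, inv_mul_cancel₀ ht0, one_smul]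

/-- **`HC(2,2)` for `S₁ × S₂` ⟺ the rational Hodge morphisms `H²(S₂) → H²(S₁)` are algebraic**, for every
pair of smooth projective complex surfaces and every orientation family `μ`: every rational `(2,2)`-class
on `S₁ ⊗ S₂` is algebraic if and only if every rational, type-preserving linear map
`H²(S₂(ℂ); ℂ) → H²(S₁(ℂ); ℂ)` is `y ↦ pr₁_*(pr₂^* y ∪ γ)` for some `γ ∈ algebraicClasses (S₁ ⊗ S₂) 2`. (⟹:
Voisin I Lemma 11.41; ⟸: `hodgeTwoTwo_algebraic_prod_of_transcendentalCorrespondences`, whose weaker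
hypothesis — agreement on `T(S₂)` only, for the morphisms killing `N¹H²(S₂)` with image orthogonal to
`N¹H²(S₁)` — is implied.) [cite: Huybrechts2019, §1] [cite: Varesco2023, §2 (p. 8)]
[cite: VoisinHodgeI2002, §11.3.3 Lemma 11.41] -/
theorem hodgeTwoTwo_algebraic_prod_iff_hodgeMorphisms_algebraic (μ : OrientationFamily)
    (h₁ : IsSmoothProjective 2 S₁) (h₂ : IsSmoothProjective 2 S₂) :
    (∀ c : complexBetti (S₁ ⊗ S₂) (2 * 2), IsRationalClass c →
        IsOfHodgeType 4 (S₁ ⊗ S₂) (2 * 2) 2 2 c → c ∈ algebraicClasses (S₁ ⊗ S₂) 2) ↔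
      ∀ (f : complexBetti S₂ (2 * 1) →ₗ[ℂ] complexBetti S₁ (2 * 1)),
        (∀ y, IsRationalClass y → IsRationalClass (f y)) →
        (∀ (i j : ℕ) y, IsOfHodgeType 2 S₂ (2 * 1) i j y → IsOfHodgeType 2 S₁ (2 * 1) i j (f y)) →
        ∃ γ ∈ algebraicClasses (S₁ ⊗ S₂) 2, ∀ y : complexBetti S₂ (2 * 1), f y = Corr[μ, h₁, h₂ ; γ, y] := by
  constructor
  · intro h22 f hf_rat hf_typ
    exact hodgeMorphism_induced_of_hodgeTwoTwo_algebraic_prod μ h₁ h₂ h22 f hf_rat hf_typ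
  · intro hM c hc hH
    refine hodgeTwoTwo_algebraic_prod_of_transcendentalCorrespondences μ h₁ h₂ (fun f hf₁ hf₂ _ _ ↦ ?_) c hc hH
    obtain ⟨γ, hγalg, hγ⟩ := hM f hf₁ hf₂
    exact ⟨γ, hγalg, fun y _ ↦ hγ y⟩

/-- **The Hodge conjecture for `S₁ × S₂` ⟺ the rational Hodge morphisms `H²(S₂) → H²(S₁)` are algebraic**
(every pair of smooth projective complex surfaces; every orientation family): `HodgeConjectureFor 4 (S₁ ⊗ S₂)`
holds if and only if every rational type-preserving `H²(S₂(ℂ); ℂ) → H²(S₁(ℂ); ℂ)` is induced by an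
algebraic class of codimension `2` on `S₁ ⊗ S₂`. The codimensions `≠ 2` are unconditional on a fourfold
(`hodgeClasses_algebraic_fourfold_of_hodgeTwoTwo` with Lefschetz `(1,1)` and hard Lefschetz); codimension `2`
is `hodgeTwoTwo_algebraic_prod_iff_hodgeMorphisms_algebraic`. [cite: Huybrechts2019, §1 and Cor. 0.4]
[cite: Varesco2023, §2 (p. 8)] [cite: VoisinHodgeI2002, Thm. 11.30, Lemma 11.41 and Thm. 6.25] -/
theorem hodgeConjectureFor_prod_iff_hodgeMorphisms_algebraic (μ : OrientationFamily)
    (h₁ : IsSmoothProjective 2 S₁) (h₂ : IsSmoothProjective 2 S₂) :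
    HodgeConjectureFor 4 (S₁ ⊗ S₂) ↔
      ∀ (f : complexBetti S₂ (2 * 1) →ₗ[ℂ] complexBetti S₁ (2 * 1)),
        (∀ y, IsRationalClass y → IsRationalClass (f y)) →
        (∀ (i j : ℕ) y, IsOfHodgeType 2 S₂ (2 * 1) i j y → IsOfHodgeType 2 S₁ (2 * 1) i j (f y)) →
        ∃ γ ∈ algebraicClasses (S₁ ⊗ S₂) 2, ∀ y : complexBetti S₂ (2 * 1), f y = Corr[μ, h₁, h₂ ; γ, y] := by
  have hX : IsSmoothProjective 4 (S₁ ⊗ S₂) := IsSmoothProjective.tensor_holds h₁ h₂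
  constructor
  · intro hHC
    exact (hodgeTwoTwo_algebraic_prod_iff_hodgeMorphisms_algebraic μ h₁ h₂).1 (hHC.2 2)
  · intro hM
    exact ⟨nonempty_hodgeModel_holds hX, fun p c hc hH ↦
      hodgeClasses_algebraic_fourfold_of_hodgeTwoTwo lefschetzOneOne_rational_holds
        (nonempty_hardLefschetzNFold_holds 4 (S₁ ⊗ S₂)) hX
        ((hodgeTwoTwo_algebraic_prod_iff_hodgeMorphisms_algebraic μ h₁ h₂).2 hM) p c hc hH⟩

end Summit.HodgeConjecture.HodgeConjecture.Theorems.SurfaceProducts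

end
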